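import Mathlib
import Summits.Ventures.PercRepro2.RootCutSupport

/-!
# The typed (SEP-3) zero, III: the two-door closure lemmas (blind cell PercRepro2, p3 g6,
2026-08-25; `proofs/P3-BRIDGE.md` §11.20)

Two vertex sets `W`, `W′` meeting only in the two DOORS `s₁, s₂`, every open edge within one of
them.  `conn_doors`: `s₁ ~ s₂` iff inside `W` or inside `W′`.  `conn_door`: a connection from
`W` to a vertex outside `W` passes through a door.  `conn_inside`: a connection between two
vertices of `W` is realised inside `W`, or goes out through one door and comes back through the
other (`s₁ ~ s₂` globally).  Own work; standard axioms.
-/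

namespace Summit.Ventures.PercRepro2

open UnionCluster

namespace CovForm

namespace SepThree

open OneTyped TypedA3 Untouched TypedFactor Separated RootBridge

/-! ## The two-door closure lemmas -/

section Closure

open Classical

variable {V : Type*} {E : Type*}
variable (ends : E → Sym2 V)

/-- An open edge within `W` connects its ends inside the `W`-restriction. -/
lemma conn_withinRestr_of_edge {W : Set V} {x : Config E} {e : E} {p q : V} (he : x e = true)
    (hends : ends e = s(p, q)) (hw : e ∈ within ends W) :
    Conn ends (withinRestr ends W x) p q := by
  refine conn_of_openAdj ⟨e, ?_, hends⟩
  simp [withinRestr, hw, he]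

/-- **Doors**: `s₁ ~ s₂` iff inside `W` or inside `W′`. -/
theorem conn_doors {W W' : Set V} {s₁ s₂ : V} {x : Config E}
    (hx : ∀ e, x e = true → e ∈ within ends W ∨ e ∈ within ends W')
    (hcap : ∀ t, t ∈ W → t ∈ W' → t = s₁ ∨ t = s₂) (h1 : s₁ ∈ W) (h1' : s₁ ∈ W') :
    Conn ends x s₁ s₂ ↔
      Conn ends (withinRestr ends W x) s₁ s₂ ∨ Conn ends (withinRestr ends W' x) s₁ s₂ := by
  constructor
  · intro h
    by_contra hne
    have hW : ¬ Conn ends (withinRestr ends W x) s₁ s₂ := fun h' => hne (Or.inl h')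
    have hW' : ¬ Conn ends (withinRestr ends W' x) s₁ s₂ := fun h' => hne (Or.inr h')
    have key : s₂ ∈ {v | (v ∈ W ∧ Conn ends (withinRestr ends W x) s₁ v) ∨
        (v ∈ W' ∧ Conn ends (withinRestr ends W' x) s₁ v)} := by
      refine mem_of_conn_of_closed (ends := ends) (ω := x) ?_ (Or.inl ⟨h1, conn_refl _ _ _⟩) h
      rintro t (⟨htW, ht⟩ | ⟨htW', ht⟩) t' htt'
      · obtain ⟨_, e, he, hends⟩ := openGraph_adj.1 htt'
        by_cases hw : e ∈ within ends W
        · exact Or.inl ⟨(ends_mem_of_within ends hw hends).2,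
            conn_trans ht (conn_withinRestr_of_edge ends he hends hw)⟩
        · have hw' : e ∈ within ends W' := (hx e he).resolve_left hw
          have hmem := ends_mem_of_within ends hw' hends
          rcases hcap t htW hmem.1 with rfl | rfl
          · exact Or.inr ⟨hmem.2, conn_withinRestr_of_edge ends he hends hw'⟩
          · exact absurd ht hW
      · obtain ⟨_, e, he, hends⟩ := openGraph_adj.1 htt'
        by_cases hw' : e ∈ within ends W'
        · exact Or.inr ⟨(ends_mem_of_within ends hw' hends).2,
            conn_trans ht (conn_withinRestr_of_edge ends he hends hw')⟩
        · have hw : e ∈ within ends W := (hx e he).resolve_right hw'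
          have hmem := ends_mem_of_within ends hw hends
          rcases hcap t hmem.1 htW' with rfl | rfl
          · exact Or.inl ⟨hmem.2, conn_withinRestr_of_edge ends he hends hw⟩
          · exact absurd ht hW'
    rcases key with ⟨_, hk⟩ | ⟨_, hk⟩
    · exact hW hk
    · exact hW' hk
  · rintro (h | h)
    · exact conn_mono (withinRestr_le ends W x) h
    · exact conn_mono (withinRestr_le ends W' x) h

/-- **Door**: a connection from `r ∈ W` to `u ∉ W` passes through a door. -/
theorem conn_door {W W' : Set V} {s₁ s₂ : V} {x : Config E}
    (hx : ∀ e, x e = true → e ∈ within ends W ∨ e ∈ within ends W')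
    (hcap : ∀ t, t ∈ W → t ∈ W' → t = s₁ ∨ t = s₂) {r u : V} (hr : r ∈ W) (hu : u ∉ W)
    (h : Conn ends x r u) :
    (Conn ends x r s₁ ∧ Conn ends x s₁ u) ∨ (Conn ends x r s₂ ∧ Conn ends x s₂ u) := by
  have key : u ∈ {v | (v ∈ W ∧ Conn ends x r v) ∨ (Conn ends x r s₁ ∧ Conn ends x s₁ v) ∨
      (Conn ends x r s₂ ∧ Conn ends x s₂ v)} := by
    refine mem_of_conn_of_closed (ends := ends) (ω := x) ?_ (Or.inl ⟨hr, conn_refl _ _ _⟩) h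
    rintro t (⟨htW, ht⟩ | ⟨h1, ht⟩ | ⟨h2, ht⟩) t' htt'
    · obtain ⟨_, e, he, hends⟩ := openGraph_adj.1 htt'
      have hconn : Conn ends x t t' := conn_of_openAdj ⟨e, he, hends⟩
      by_cases hw : e ∈ within ends W
      · exact Or.inl ⟨(ends_mem_of_within ends hw hends).2, conn_trans ht hconn⟩
      · have hw' : e ∈ within ends W' := (hx e he).resolve_left hw
        have hmem := ends_mem_of_within ends hw' hends
        rcases hcap t htW hmem.1 with rfl | rfl
        · exact Or.inr (Or.inl ⟨ht, hconn⟩)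
        · exact Or.inr (Or.inr ⟨ht, hconn⟩)
    · obtain ⟨_, e, he, hends⟩ := openGraph_adj.1 htt'
      exact Or.inr (Or.inl ⟨h1, conn_trans ht (conn_of_openAdj ⟨e, he, hends⟩)⟩)
    · obtain ⟨_, e, he, hends⟩ := openGraph_adj.1 htt'
      exact Or.inr (Or.inr ⟨h2, conn_trans ht (conn_of_openAdj ⟨e, he, hends⟩)⟩)
  rcases key with ⟨huW, _⟩ | h | h
  · exact absurd huW hu
  · exact Or.inl h
  · exact Or.inr h

/-- **Inside**: a connection between `r, u ∈ W` is realised inside `W`, or leaves through one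
door and returns through the other (so `s₁ ~ s₂`). -/
theorem conn_inside {W W' : Set V} {s₁ s₂ : V} {x : Config E}
    (hx : ∀ e, x e = true → e ∈ within ends W ∨ e ∈ within ends W')
    (hcap : ∀ t, t ∈ W → t ∈ W' → t = s₁ ∨ t = s₂) (h1 : s₁ ∈ W) (h1' : s₁ ∈ W') (h2 : s₂ ∈ W)
    (h2' : s₂ ∈ W') {r u : V} (hr : r ∈ W) (hu : u ∈ W) :
    Conn ends x r u ↔
      Conn ends (withinRestr ends W x) r u ∨
        (Conn ends x s₁ s₂ ∧
          ((Conn ends (withinRestr ends W x) r s₁ ∧ Conn ends (withinRestr ends W x) s₂ u) ∨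
            (Conn ends (withinRestr ends W x) r s₂ ∧ Conn ends (withinRestr ends W x) s₁ u))) := by
  constructor
  · intro h
    -- the closed set: inside `W` from `r`; or through the doors inside `W`; or out in `W′`
    -- having left through a door
    have key : u ∈ {v | (v ∈ W ∧ Conn ends (withinRestr ends W x) r v) ∨
        (v ∈ W ∧ Conn ends x s₁ s₂ ∧
          ((Conn ends (withinRestr ends W x) r s₁ ∧ Conn ends (withinRestr ends W x) s₂ v) ∨
            (Conn ends (withinRestr ends W x) r s₂ ∧
              Conn ends (withinRestr ends W x) s₁ v))) ∨
        (v ∈ W' ∧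
          ((Conn ends (withinRestr ends W x) r s₁ ∧
            Conn ends (withinRestr ends W' x) s₁ v) ∨
            (Conn ends (withinRestr ends W x) r s₂ ∧
              Conn ends (withinRestr ends W' x) s₂ v)))} := by
      refine mem_of_conn_of_closed (ends := ends) (ω := x) ?_ (Or.inl ⟨hr, conn_refl _ _ _⟩) h
      rintro t ht t' htt'
      obtain ⟨_, e, he, hends⟩ := openGraph_adj.1 htt'
      have hdoors := conn_doors ends hx hcap h1 h1' (s₂ := s₂) (x := x)
      by_cases hw : e ∈ within ends W
      · -- the edge lies within `W`
        have hmem := ends_mem_of_within ends hw hends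
        have hc : Conn ends (withinRestr ends W x) t t' := conn_withinRestr_of_edge ends he hends hw
        rcases ht with ⟨_, ht⟩ | ⟨_, h12, ⟨hr1, ht⟩ | ⟨hr2, ht⟩⟩ | ⟨htW', ⟨hr1, ht⟩ | ⟨hr2, ht⟩⟩
        · exact Or.inl ⟨hmem.2, conn_trans ht hc⟩
        · exact Or.inr (Or.inl ⟨hmem.2, h12, Or.inl ⟨hr1, conn_trans ht hc⟩⟩)
        · exact Or.inr (Or.inl ⟨hmem.2, h12, Or.inr ⟨hr2, conn_trans ht hc⟩⟩)
        · rcases hcap t hmem.1 htW' with rfl | rfl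
          · exact Or.inl ⟨hmem.2, conn_trans hr1 hc⟩
          · have h12 : Conn ends x s₁ t := hdoors.2 (Or.inr ht)
            exact Or.inr (Or.inl ⟨hmem.2, h12, Or.inl ⟨hr1, hc⟩⟩)
        · rcases hcap t hmem.1 htW' with rfl | rfl
          · have h12 : Conn ends x t s₂ := hdoors.2 (Or.inr (conn_symm ht))
            exact Or.inr (Or.inl ⟨hmem.2, h12, Or.inr ⟨hr2, hc⟩⟩)
          · exact Or.inl ⟨hmem.2, conn_trans hr2 hc⟩
      · -- the edge lies within `W′` only
        have hw' : e ∈ within ends W' := (hx e he).resolve_left hw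
        have hmem := ends_mem_of_within ends hw' hends
        have hc : Conn ends (withinRestr ends W' x) t t' :=
          conn_withinRestr_of_edge ends he hends hw'
        rcases ht with ⟨htW, ht⟩ | ⟨htW, h12, ⟨hr1, ht⟩ | ⟨hr2, ht⟩⟩ | ⟨_, ⟨hr1, ht⟩ | ⟨hr2, ht⟩⟩
        · rcases hcap t htW hmem.1 with rfl | rfl
          · exact Or.inr (Or.inr ⟨hmem.2, Or.inl ⟨ht, hc⟩⟩)
          · exact Or.inr (Or.inr ⟨hmem.2, Or.inr ⟨ht, hc⟩⟩)
        · rcases hcap t htW hmem.1 with rfl | rfl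
          · exact Or.inr (Or.inr ⟨hmem.2, Or.inl ⟨hr1, hc⟩⟩)
          · -- at `s₂` with `r ~_W s₁`: use `s₁ ~ s₂` inside `W` or inside `W′`
            rcases hdoors.1 h12 with hX | hY
            · exact Or.inr (Or.inr ⟨hmem.2, Or.inr ⟨conn_trans hr1 hX, hc⟩⟩)
            · exact Or.inr (Or.inr ⟨hmem.2, Or.inl ⟨hr1, conn_trans hY hc⟩⟩)
        · rcases hcap t htW hmem.1 with rfl | rfl
          · rcases hdoors.1 h12 with hX | hY
            · exact Or.inr (Or.inr ⟨hmem.2, Or.inl ⟨conn_trans hr2 (conn_symm hX), hc⟩⟩)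
            · exact Or.inr (Or.inr ⟨hmem.2, Or.inr ⟨hr2, conn_trans (conn_symm hY) hc⟩⟩)
          · exact Or.inr (Or.inr ⟨hmem.2, Or.inr ⟨hr2, hc⟩⟩)
        · exact Or.inr (Or.inr ⟨hmem.2, Or.inl ⟨hr1, conn_trans ht hc⟩⟩)
        · exact Or.inr (Or.inr ⟨hmem.2, Or.inr ⟨hr2, conn_trans ht hc⟩⟩)
    have hdoors := conn_doors ends hx hcap h1 h1' (s₂ := s₂) (x := x)
    rcases key with ⟨_, hk⟩ | ⟨_, h12, hk⟩ | ⟨huW', ⟨hr1, hk⟩ | ⟨hr2, hk⟩⟩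
    · exact Or.inl hk
    · exact Or.inr ⟨h12, hk⟩
    · rcases hcap u hu huW' with rfl | rfl
      · exact Or.inl hr1
      · exact Or.inr ⟨hdoors.2 (Or.inr hk), Or.inl ⟨hr1, conn_refl _ _ _⟩⟩
    · rcases hcap u hu huW' with rfl | rfl
      · exact Or.inr ⟨hdoors.2 (Or.inr (conn_symm hk)), Or.inr ⟨hr2, conn_refl _ _ _⟩⟩
      · exact Or.inl hr2
  · rintro (h | ⟨h12, ⟨hr1, h2u⟩ | ⟨hr2, h1u⟩⟩)
    · exact conn_mono (withinRestr_le ends W x) h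
    · exact conn_trans (conn_mono (withinRestr_le ends W x) hr1)
        (conn_trans h12 (conn_mono (withinRestr_le ends W x) h2u))
    · exact conn_trans (conn_mono (withinRestr_le ends W x) hr2)
        (conn_trans (conn_symm h12) (conn_mono (withinRestr_le ends W x) h1u))

end Closure

end SepThree

end CovForm

end Summit.Ventures.PercRepro2
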